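import Literature.Claims.NS.Wu2026
import Literature.Analysis.FluidPDE.RadialCalculus
import Mathlib.Analysis.SpecialFunctions.SmoothTransition
import Mathlib.Analysis.SpecialFunctions.Integrals.Basic
import Mathlib.MeasureTheory.Integral.IntervalIntegral.FundThmCalculus
import HarnessLib

/-!
# C177 `Wu2026` — SALVAGE (TRUE column), tool for (3.82): smooth superharmonic radial profiles
# approximating the harmonic cut-off `Φ_R = min{1, R/|x|}`

Cell `ns-claims` (D-0090), lane ns-claims-salvage-p6 g5 (handover of salvage-p3 g6 CLOSING §: second
conjunct of `Literature.Claims.NS.Wu2026.Step_382`). Records-grade for the row (#164 «discharges»).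

The print (arXiv:2608.22471v1, p.24 l.91 – p.25 l.20) tests the pointwise energy identity (3.72) with
`Φ_R χ_L`, «first smooth[ing] Φ_R in a thin neighborhood of S_R» and letting `ε ↓ 0`, which produces
the sphere term `(2R)⁻¹∫_{S_R}|v|²` from the negative surface measure `ΔΦ_R = −R⁻¹ H²⌊S_R` (3.80); the
sphere term is then used «only through its nonnegativity» (Remark 3.5). This file builds, for `R > 0`
and `ε > 0`, a **smooth SUPERHARMONIC radial profile** `h_{R,ε}(x) = g_{R,ε}(|x|²)` that makes the
favourable sign available WITHOUT surface measures:

* `rampDens R ε s = θ(s)·s^{−3/2}` with the smooth monotone ramp `θ = smoothTransition((s−R²)/((R+ε)²−R²))`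
  (`0` for `s ≤ R²`, `1` for `s ≥ (R+ε)²`); `profile R ε σ = R/(R+ε) + (R/2)∫_σ^{(R+ε)²} rampDens`;
* `profile′ = −(R/2)·rampDens` (FTC), `profile` is `C^∞`, constant (`= profile R ε (R²) ∈ [R/(R+ε), 1]`)
  on `σ ≤ R²`, EQUAL to `R σ^{−1/2}` for `σ ≥ (R+ε)²`, and `0 ≤ profile ≤ min{1, Rσ^{−1/2}}`;
* in the variable `σ = |x|²` the Laplacian of a radial function is `4σg″ + 6g′`
  (`RadialCalculus.laplacian_comp_norm_sq`, `d = 3`), and here `4σ·profile″ + 6·profile′ = −2Rθ′(σ)σ^{−1/2} ≤ 0`: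
  the lift `radialProfile R ε x = profile R ε (‖x‖²)` (sibling file `SoloSalvageWu2026CutoffRadial`) is
  `C²`, `0 ≤ · ≤ Φ_R`-shaped, with `∇ radialProfile(x)·w = −R θ(|x|²)|x|^{−3}⟪x, w⟫` and `Δ ≤ 0`.

As `ε → 0`, `radialProfile R ε → Φ_R` pointwise and `∇ radialProfile R ε (x) → −R x|x|^{−3} 𝟙_{|x|>R}
= ∇Φ_R` ((3.80)); the consumer file `SoloSalvageWu2026HarmonicCutoff` runs the single dominated-convergence
limit that yields (3.82) in the consumed form `∫Φ_R ν|∇v|² ≤ −R∫_{|x|>R} 𝒬 v·x|x|^{−3}`.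

WHAT THIS IS NOT: not a claim about NS regularity or blow-up; not a claim about any author beyond the
typed locator.
-/

set_option linter.dupNamespace false

noncomputable section

open MeasureTheory Set Filter Topology InnerProductSpace
open scoped RealInnerProductSpace Laplacian Topology

namespace Summit.NavierStokesRegularity.NavierStokesRegularity.Theorems.Wu2026Salvage

open Literature.Analysis.FluidPDE Literature.Claims.NS.Wu2026

/-! ### §1 The ramp `θ_{R,ε}` and the density `θ(s)s^{−3/2}` -/

/-- The width `δ = (R+ε)² − R²` of the transition layer in the variable `σ = |x|²`. [cite: Wu2026, p.25 l.15–20 (smoothing Φ_R near S_R)] -/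
def layerWidth (R ε : ℝ) : ℝ := (R + ε) ^ 2 - R ^ 2

/-- The smooth monotone ramp `θ(s) = smoothTransition((s − R²)/δ)`: `0` for `s ≤ R²`, `1` for
`s ≥ (R+ε)²`. [cite: Wu2026, p.25 l.15–20 (smoothing Φ_R near S_R)] -/
def ramp (R ε s : ℝ) : ℝ := Real.smoothTransition ((s - R ^ 2) / layerWidth R ε)

/-- The density `θ(s)·s^{−3/2}` whose primitive is the profile (`−(2/R)·profile′`). [cite: Wu2026, (3.80) p.24 (∇Φ_R = −Rx|x|⁻³ off B_R)] -/
def rampDens (R ε s : ℝ) : ℝ := ramp R ε s * s ^ (-(3 / 2 : ℝ))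

/-- The layer has positive width. [cite: Wu2026, p.25 l.15–20] -/
theorem layerWidth_pos {R ε : ℝ} (hR : 0 < R) (hε : 0 < ε) : 0 < layerWidth R ε := by
  unfold layerWidth; nlinarith

/-- `θ` is smooth. [cite: Wu2026, p.25 l.15–20] -/
theorem contDiff_ramp (R ε : ℝ) {n : ℕ∞} : ContDiff ℝ n (ramp R ε) :=
  Real.smoothTransition.contDiff.comp ((contDiff_id.sub contDiff_const).div_const _)

/-- `0 ≤ θ ≤ 1`. [cite: Wu2026, p.25 l.15–20] -/
theorem ramp_nonneg_le_one (R ε s : ℝ) : 0 ≤ ramp R ε s ∧ ramp R ε s ≤ 1 :=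
  ⟨Real.smoothTransition.nonneg _, Real.smoothTransition.le_one _⟩

/-- `θ(s) = 0` for `s ≤ R²`. [cite: Wu2026, p.25 l.15–20] -/
theorem ramp_eq_zero {R ε s : ℝ} (hR : 0 < R) (hε : 0 < ε) (hs : s ≤ R ^ 2) : ramp R ε s = 0 :=
  Real.smoothTransition.zero_of_nonpos
    (div_nonpos_of_nonpos_of_nonneg (sub_nonpos.2 hs) (layerWidth_pos hR hε).le)

/-- `θ(s) = 1` for `s ≥ (R+ε)²`. [cite: Wu2026, p.25 l.15–20] -/
theorem ramp_eq_one {R ε s : ℝ} (hR : 0 < R) (hε : 0 < ε) (hs : (R + ε) ^ 2 ≤ s) : ramp R ε s = 1 := by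
  refine Real.smoothTransition.one_of_one_le ?_
  rw [le_div_iff₀ (layerWidth_pos hR hε), one_mul]
  unfold layerWidth; linarith

/-- `θ` is monotone. [cite: Wu2026, p.25 l.15–20] -/
theorem monotone_ramp {R ε : ℝ} (hR : 0 < R) (hε : 0 < ε) : Monotone (ramp R ε) := fun _ _ hab =>
  Real.smoothTransition.monotone
    (div_le_div_of_nonneg_right (sub_le_sub_right hab _) (layerWidth_pos hR hε).le)

/-- `θ′ ≥ 0`. [cite: Wu2026, p.25 l.15–20] -/
theorem deriv_ramp_nonneg {R ε : ℝ} (hR : 0 < R) (hε : 0 < ε) (s : ℝ) : 0 ≤ deriv (ramp R ε) s :=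
  (((contDiff_ramp R ε (n := 1)).differentiable one_ne_zero) s).hasDerivAt.nonneg_of_monotone
    (monotone_ramp hR hε)

/-- `θ` vanishes on a neighbourhood of every `s < R²`. [cite: Wu2026, p.25 l.15–20] -/
theorem ramp_eventuallyEq_zero {R ε s : ℝ} (hR : 0 < R) (hε : 0 < ε) (hs : s < R ^ 2) :
    ramp R ε =ᶠ[𝓝 s] fun _ => 0 := by
  filter_upwards [Iio_mem_nhds hs] with t ht using ramp_eq_zero hR hε (le_of_lt ht)

/-- The density is smooth: near `s < R²` it vanishes identically, and on `s > 0` it is a product of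
smooth functions. [cite: Wu2026, p.25 l.15–20] -/
theorem contDiff_rampDens {R ε : ℝ} (hR : 0 < R) (hε : 0 < ε) {n : ℕ∞} :
    ContDiff ℝ n (rampDens R ε) := by
  refine contDiff_iff_contDiffAt.2 fun s => ?_
  by_cases hs : s < R ^ 2
  · have hev : rampDens R ε =ᶠ[𝓝 s] fun _ => 0 := by
      filter_upwards [ramp_eventuallyEq_zero hR hε hs] with t ht
      rw [rampDens, ht, zero_mul]
    exact (contDiffAt_const (c := (0 : ℝ))).congr_of_eventuallyEq hev
  · have hs0 : s ≠ 0 := by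
      have : 0 < R ^ 2 := by positivity
      intro h; rw [h] at hs; exact hs this
    exact ((contDiff_ramp R ε).contDiffAt).mul (Real.contDiffAt_rpow_const_of_ne hs0)

/-- The density is continuous. [cite: Wu2026, p.25 l.15–20] -/
theorem continuous_rampDens {R ε : ℝ} (hR : 0 < R) (hε : 0 < ε) : Continuous (rampDens R ε) :=
  (contDiff_rampDens hR hε (n := 0)).continuous

/-- `rampDens = 0` on `s ≤ R²`. [cite: Wu2026, (3.80) p.24] -/
theorem rampDens_eq_zero {R ε s : ℝ} (hR : 0 < R) (hε : 0 < ε) (hs : s ≤ R ^ 2) : rampDens R ε s = 0 := by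
  rw [rampDens, ramp_eq_zero hR hε hs, zero_mul]

/-- `0 ≤ rampDens s ≤ s^{−3/2}` for `s > 0` (and `rampDens s = 0` for `s ≤ 0`). [cite: Wu2026, (3.80) p.24] -/
theorem rampDens_nonneg {R ε : ℝ} (hR : 0 < R) (hε : 0 < ε) (s : ℝ) : 0 ≤ rampDens R ε s := by
  by_cases hs : s ≤ R ^ 2
  · rw [rampDens_eq_zero hR hε hs]
  · have hs0 : 0 < s := lt_of_lt_of_le (by positivity) (not_le.1 hs).le
    exact mul_nonneg (ramp_nonneg_le_one R ε s).1 (Real.rpow_nonneg hs0.le _)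

/-- `rampDens s ≤ s^{−3/2}` for `s > 0`. [cite: Wu2026, (3.80) p.24] -/
theorem rampDens_le_rpow {R ε s : ℝ} (hs : 0 < s) : rampDens R ε s ≤ s ^ (-(3 / 2 : ℝ)) :=
  mul_le_of_le_one_left (Real.rpow_nonneg hs.le _) (ramp_nonneg_le_one R ε s).2

/-- `rampDens s = s^{−3/2}` for `s ≥ (R+ε)²`. [cite: Wu2026, (3.80) p.24] -/
theorem rampDens_eq_rpow {R ε s : ℝ} (hR : 0 < R) (hε : 0 < ε) (hs : (R + ε) ^ 2 ≤ s) :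
    rampDens R ε s = s ^ (-(3 / 2 : ℝ)) := by
  rw [rampDens, ramp_eq_one hR hε hs, one_mul]

/-! ### §2 The profile `g_{R,ε}` in the variable `σ = |x|²` -/

/-- The radial profile `g(σ) = R/(R+ε) + (R/2)∫_σ^{(R+ε)²} θ(s)s^{−3/2} ds`. [cite: Wu2026, p.25 l.15–20 (Φ_{R,ε})] -/
def profile (R ε σ : ℝ) : ℝ := R / (R + ε) + R / 2 * ∫ s in σ..(R + ε) ^ 2, rampDens R ε s

/-- FTC: `g′(σ) = −(R/2)θ(σ)σ^{−3/2}`. [cite: Wu2026, (3.80) p.24] -/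
theorem hasDerivAt_profile {R ε : ℝ} (hR : 0 < R) (hε : 0 < ε) (σ : ℝ) :
    HasDerivAt (profile R ε) (-(R / 2 * rampDens R ε σ)) σ := by
  have hc := continuous_rampDens hR hε
  have h := intervalIntegral.integral_hasDerivAt_left (hc.intervalIntegrable _ _)
    (hc.stronglyMeasurableAtFilter _ _) hc.continuousAt (b := (R + ε) ^ 2) (a := σ)
  show HasDerivAt (fun u => R / (R + ε) + R / 2 * ∫ s in u..(R + ε) ^ 2, rampDens R ε s) _ _
  have := (h.const_mul (R / 2)).const_add (R / (R + ε))
  simpa [mul_neg] using this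

/-- `deriv g = −(R/2)·rampDens`. [cite: Wu2026, (3.80) p.24] -/
theorem deriv_profile {R ε : ℝ} (hR : 0 < R) (hε : 0 < ε) :
    deriv (profile R ε) = fun σ => -(R / 2 * rampDens R ε σ) :=
  funext fun σ => (hasDerivAt_profile hR hε σ).deriv

/-- The profile is smooth. [cite: Wu2026, p.25 l.15–20] -/
theorem contDiff_profile {R ε : ℝ} (hR : 0 < R) (hε : 0 < ε) {n : ℕ∞} : ContDiff ℝ n (profile R ε) := by
  have htop : ContDiff ℝ ((⊤ : ℕ∞) : WithTop ℕ∞) (profile R ε) := by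
    rw [contDiff_infty_iff_deriv]
    refine ⟨fun σ => (hasDerivAt_profile hR hε σ).differentiableAt, ?_⟩
    rw [deriv_profile hR hε]
    have h1 : ContDiff ℝ ((⊤ : ℕ∞) : WithTop ℕ∞) (rampDens R ε) := contDiff_rampDens hR hε
    exact (contDiff_const.mul h1).neg
  exact htop.of_le (by exact_mod_cast le_top)

/-- Beyond the layer the profile IS `R σ^{−1/2}`. [cite: Wu2026, (3.79) p.24 (Φ_R = R/|x| off B_R)] -/
theorem profile_eq_of_le {R ε σ : ℝ} (hR : 0 < R) (hε : 0 < ε) (hσ : (R + ε) ^ 2 ≤ σ) :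
    profile R ε σ = R * σ ^ (-(1 / 2 : ℝ)) := by
  have hRe : 0 < R + ε := by linarith
  have hRe2 : 0 < (R + ε) ^ 2 := by positivity
  have hσ0 : 0 < σ := hRe2.trans_le hσ
  have h1 : ∫ s in σ..(R + ε) ^ 2, rampDens R ε s = ∫ s in σ..(R + ε) ^ 2, s ^ (-(3 / 2 : ℝ)) := by
    refine intervalIntegral.integral_congr fun s hs => ?_
    rw [uIcc_of_ge hσ] at hs
    exact rampDens_eq_rpow hR hε hs.1
  have h2 : ∫ s in σ..(R + ε) ^ 2, s ^ (-(3 / 2 : ℝ)) =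
      (((R + ε) ^ 2) ^ (-(3 / 2 : ℝ) + 1) - σ ^ (-(3 / 2 : ℝ) + 1)) / (-(3 / 2 : ℝ) + 1) := by
    refine integral_rpow (Or.inr ⟨by norm_num, ?_⟩)
    rw [uIcc_of_ge hσ]
    exact fun h => (lt_irrefl (0 : ℝ)) (hRe2.trans_le h.1)
  have h3 : ((R + ε) ^ 2 : ℝ) ^ (-(3 / 2 : ℝ) + 1) = (R + ε)⁻¹ := by
    rw [show (-(3 / 2 : ℝ) + 1) = -(1 / 2 : ℝ) by norm_num, Real.rpow_neg hRe2.le,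
      show ((R + ε) ^ 2 : ℝ) = (R + ε) ^ (2 : ℝ) by norm_cast, ← Real.rpow_mul hRe.le]
    norm_num
  rw [profile, h1, h2, h3, show (-(3 / 2 : ℝ) + 1) = -(1 / 2 : ℝ) by norm_num]
  field_simp
  ring

/-- Inside `B_R` (i.e. `σ ≤ R²`) the profile is constant, equal to `g(R²)`. [cite: Wu2026, (3.79) p.24 (Φ_R = 1 on B_R)] -/
theorem profile_eq_of_le_sq {R ε σ : ℝ} (hR : 0 < R) (hε : 0 < ε) (hσ : σ ≤ R ^ 2) :
    profile R ε σ = profile R ε (R ^ 2) := by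
  have hc := continuous_rampDens hR hε
  rw [profile, profile, ← intervalIntegral.integral_add_adjacent_intervals
    (hc.intervalIntegrable σ (R ^ 2)) (hc.intervalIntegrable (R ^ 2) ((R + ε) ^ 2))]
  have h0 : ∫ s in σ..R ^ 2, rampDens R ε s = 0 := by
    rw [intervalIntegral.integral_congr (g := fun _ => (0 : ℝ)) fun s hs => ?_]
    · simp
    · rw [uIcc_of_le hσ] at hs
      exact rampDens_eq_zero hR hε hs.2
  rw [h0, zero_add]

/-- The plateau value lies in `[R/(R+ε), 1]`. [cite: Wu2026, (3.79) p.24] -/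
theorem profile_sq_mem {R ε : ℝ} (hR : 0 < R) (hε : 0 < ε) :
    R / (R + ε) ≤ profile R ε (R ^ 2) ∧ profile R ε (R ^ 2) ≤ 1 := by
  have hRe : 0 < R + ε := by linarith
  have hle : R ^ 2 ≤ (R + ε) ^ 2 := by nlinarith
  have hR2 : 0 < R ^ 2 := by positivity
  have hc := continuous_rampDens hR hε
  constructor
  · have : 0 ≤ ∫ s in R ^ 2..(R + ε) ^ 2, rampDens R ε s :=
      intervalIntegral.integral_nonneg hle fun s _ => rampDens_nonneg hR hε s
    unfold profile
    nlinarith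
  · have hmono : ∫ s in R ^ 2..(R + ε) ^ 2, rampDens R ε s ≤ ∫ s in R ^ 2..(R + ε) ^ 2, s ^ (-(3 / 2 : ℝ)) := by
      refine intervalIntegral.integral_mono_on hle (hc.intervalIntegrable _ _) ?_ fun s hs => ?_
      · refine (continuousOn_id.rpow_const fun s hs => Or.inl ?_).intervalIntegrable_of_Icc hle
        exact (hR2.trans_le hs.1).ne'
      · exact rampDens_le_rpow (hR2.trans_le hs.1)
    have hval : ∫ s in R ^ 2..(R + ε) ^ 2, s ^ (-(3 / 2 : ℝ)) = 2 * (R⁻¹ - (R + ε)⁻¹) := by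
      rw [integral_rpow (Or.inr ⟨by norm_num, ?_⟩)]
      · have e1 : ((R + ε) ^ 2 : ℝ) ^ (-(3 / 2 : ℝ) + 1) = (R + ε)⁻¹ := by
          rw [show (-(3 / 2 : ℝ) + 1) = -(1 / 2 : ℝ) by norm_num, Real.rpow_neg (by positivity),
            show ((R + ε) ^ 2 : ℝ) = (R + ε) ^ (2 : ℝ) by norm_cast, ← Real.rpow_mul hRe.le]
          norm_num
        have e2 : (R ^ 2 : ℝ) ^ (-(3 / 2 : ℝ) + 1) = R⁻¹ := by
          rw [show (-(3 / 2 : ℝ) + 1) = -(1 / 2 : ℝ) by norm_num, Real.rpow_neg (by positivity),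
            show (R ^ 2 : ℝ) = R ^ (2 : ℝ) by norm_cast, ← Real.rpow_mul hR.le]
          norm_num
        rw [e1, e2]; norm_num; ring
      · rw [uIcc_of_le hle]
        exact fun h => (lt_irrefl (0 : ℝ)) (hR2.trans_le h.1)
    have key : R / (R + ε) + R / 2 * (2 * (R⁻¹ - (R + ε)⁻¹)) = 1 := by
      field_simp; ring
    unfold profile
    calc R / (R + ε) + R / 2 * ∫ s in R ^ 2..(R + ε) ^ 2, rampDens R ε s
        ≤ R / (R + ε) + R / 2 * (2 * (R⁻¹ - (R + ε)⁻¹)) := by rw [← hval]; gcongr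
      _ = 1 := key

/-- The profile is non-increasing. [cite: Wu2026, (3.79)–(3.80) p.24] -/
theorem antitone_profile {R ε : ℝ} (hR : 0 < R) (hε : 0 < ε) : Antitone (profile R ε) :=
  antitone_of_deriv_nonpos (fun σ => (hasDerivAt_profile hR hε σ).differentiableAt) fun σ => by
    rw [deriv_profile hR hε]
    have := rampDens_nonneg hR hε σ
    nlinarith

/-- `g(σ) ≤ 1`. [cite: Wu2026, (3.79) p.24] -/
theorem profile_le_one {R ε : ℝ} (hR : 0 < R) (hε : 0 < ε) (σ : ℝ) : profile R ε σ ≤ 1 := by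
  rcases le_total σ (R ^ 2) with h | h
  · rw [profile_eq_of_le_sq hR hε h]; exact (profile_sq_mem hR hε).2
  · exact (antitone_profile hR hε h).trans (profile_sq_mem hR hε).2

/-- `g(σ) ≥ 0` (indeed `≥ R σ^{−1/2}`-tail). [cite: Wu2026, (3.79) p.24] -/
theorem profile_nonneg {R ε : ℝ} (hR : 0 < R) (hε : 0 < ε) (σ : ℝ) : 0 ≤ profile R ε σ := by
  rcases le_total σ ((R + ε) ^ 2) with h | h
  · have : 0 ≤ ∫ s in σ..(R + ε) ^ 2, rampDens R ε s :=
      intervalIntegral.integral_nonneg h fun s _ => rampDens_nonneg hR hε s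
    have hRe : 0 < R + ε := by linarith
    unfold profile; positivity
  · rw [profile_eq_of_le hR hε h]
    exact mul_nonneg hR.le (Real.rpow_nonneg (by nlinarith) _)

/-- `g(σ) ≤ R σ^{−1/2}` for `σ > 0` (the profile lies BELOW the harmonic tail everywhere).
[cite: Wu2026, (3.79) p.24] -/
theorem profile_le_tail {R ε σ : ℝ} (hR : 0 < R) (hε : 0 < ε) (hσ : 0 < σ) :
    profile R ε σ ≤ R * σ ^ (-(1 / 2 : ℝ)) := by
  rcases le_total σ ((R + ε) ^ 2) with h | h
  · have hRe : 0 < R + ε := by linarith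
    have hc := continuous_rampDens hR hε
    have hmono : ∫ s in σ..(R + ε) ^ 2, rampDens R ε s ≤ ∫ s in σ..(R + ε) ^ 2, s ^ (-(3 / 2 : ℝ)) := by
      refine intervalIntegral.integral_mono_on h (hc.intervalIntegrable _ _) ?_ fun s hs => ?_
      · refine (continuousOn_id.rpow_const fun s hs => Or.inl ?_).intervalIntegrable_of_Icc h
        exact (hσ.trans_le hs.1).ne'
      · exact rampDens_le_rpow (hσ.trans_le hs.1)
    have hval : ∫ s in σ..(R + ε) ^ 2, s ^ (-(3 / 2 : ℝ)) = 2 * (σ ^ (-(1 / 2 : ℝ)) - (R + ε)⁻¹) := by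
      rw [integral_rpow (Or.inr ⟨by norm_num, ?_⟩)]
      · have e1 : ((R + ε) ^ 2 : ℝ) ^ (-(3 / 2 : ℝ) + 1) = (R + ε)⁻¹ := by
          rw [show (-(3 / 2 : ℝ) + 1) = -(1 / 2 : ℝ) by norm_num, Real.rpow_neg (by positivity),
            show ((R + ε) ^ 2 : ℝ) = (R + ε) ^ (2 : ℝ) by norm_cast, ← Real.rpow_mul hRe.le]
          norm_num
        rw [e1, show (-(3 / 2 : ℝ) + 1) = -(1 / 2 : ℝ) by norm_num]
        field_simp
        ring
      · rw [uIcc_of_le h]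
        exact fun h' => (lt_irrefl (0 : ℝ)) (hσ.trans_le h'.1)
    have key : R / (R + ε) + R / 2 * (2 * (σ ^ (-(1 / 2 : ℝ)) - (R + ε)⁻¹)) = R * σ ^ (-(1 / 2 : ℝ)) := by
      field_simp; ring
    unfold profile
    calc R / (R + ε) + R / 2 * ∫ s in σ..(R + ε) ^ 2, rampDens R ε s
        ≤ R / (R + ε) + R / 2 * (2 * (σ ^ (-(1 / 2 : ℝ)) - (R + ε)⁻¹)) := by rw [← hval]; gcongr
      _ = R * σ ^ (-(1 / 2 : ℝ)) := key
  · rw [profile_eq_of_le hR hε h]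

/-! ### §3 Second derivative and the superharmonicity identity `4σg″ + 6g′ = −2Rθ′(σ)σ^{−1/2}` -/

/-- The second derivative of the profile (a formula valid at every `σ`). [cite: Wu2026, (3.80) p.24] -/
def profileDD (R ε σ : ℝ) : ℝ :=
  -(R / 2 * (deriv (ramp R ε) σ * σ ^ (-(3 / 2 : ℝ)) + ramp R ε σ * (-(3 / 2 : ℝ) * σ ^ (-(3 / 2 : ℝ) - 1))))

/-- `g′` has derivative `profileDD`. [cite: Wu2026, (3.80) p.24] -/
theorem hasDerivAt_deriv_profile {R ε : ℝ} (hR : 0 < R) (hε : 0 < ε) (σ : ℝ) :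
    HasDerivAt (fun s => -(R / 2 * rampDens R ε s)) (profileDD R ε σ) σ := by
  unfold profileDD
  by_cases hs : σ < R ^ 2
  · -- locally zero
    have hev : (fun s => -(R / 2 * rampDens R ε s)) =ᶠ[𝓝 σ] fun _ => 0 := by
      filter_upwards [Iio_mem_nhds hs] with t ht
      rw [rampDens_eq_zero hR hε (le_of_lt ht), mul_zero, neg_zero]
    have hθ0 : ramp R ε σ = 0 := ramp_eq_zero hR hε hs.le
    have hθ'0 : deriv (ramp R ε) σ = 0 := by
      rw [(ramp_eventuallyEq_zero hR hε hs).deriv_eq]; simp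
    rw [hθ0, hθ'0]
    simp only [zero_mul, mul_zero, add_zero, neg_zero]
    exact (hasDerivAt_const σ (0 : ℝ)).congr_of_eventuallyEq hev
  · have hσ0 : σ ≠ 0 := by
      have : 0 < R ^ 2 := by positivity
      intro h; rw [h] at hs; exact hs this
    have h1 : HasDerivAt (ramp R ε) (deriv (ramp R ε) σ) σ :=
      (((contDiff_ramp R ε (n := 1)).differentiable one_ne_zero) σ).hasDerivAt
    have h2 : HasDerivAt (fun s : ℝ => s ^ (-(3 / 2 : ℝ))) (-(3 / 2 : ℝ) * σ ^ (-(3 / 2 : ℝ) - 1)) σ :=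
      Real.hasDerivAt_rpow_const (Or.inl hσ0)
    have h3 := ((h1.mul h2).const_mul (R / 2)).neg
    exact h3

/-- **Superharmonicity in the variable `σ = |x|²`:** `4σ·g″(σ) + 6·g′(σ) = −2R θ′(σ) σ^{−1/2}` for
`σ > 0`. [cite: Wu2026, (3.80) p.24 (ΔΦ_R ≤ 0 as a measure)] -/
theorem radial_laplacian_identity {R ε σ : ℝ} (hσ : 0 < σ) :
    4 * profileDD R ε σ * σ + 2 * (3 : ℕ) * (-(R / 2 * rampDens R ε σ)) =
      -(2 * R * deriv (ramp R ε) σ * σ ^ (-(1 / 2 : ℝ))) := by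
  unfold profileDD rampDens
  have e1 : σ ^ (-(3 / 2 : ℝ) - 1) * σ = σ ^ (-(3 / 2 : ℝ)) := by
    rw [show σ ^ (-(3 / 2 : ℝ)) = σ ^ (-(3 / 2 : ℝ) - 1 + 1) by norm_num, Real.rpow_add hσ, Real.rpow_one]
  have e2 : σ ^ (-(3 / 2 : ℝ)) * σ = σ ^ (-(1 / 2 : ℝ)) := by
    rw [show σ ^ (-(1 / 2 : ℝ)) = σ ^ (-(3 / 2 : ℝ) + 1) by norm_num, Real.rpow_add hσ, Real.rpow_one]
  have : 4 * -(R / 2 * (deriv (ramp R ε) σ * σ ^ (-(3 / 2 : ℝ)) +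
      ramp R ε σ * (-(3 / 2 : ℝ) * σ ^ (-(3 / 2 : ℝ) - 1)))) * σ =
      -(2 * R * deriv (ramp R ε) σ * (σ ^ (-(3 / 2 : ℝ)) * σ)) +
        3 * R * ramp R ε σ * (σ ^ (-(3 / 2 : ℝ) - 1) * σ) := by ring
  rw [this, e1, e2]
  push_cast
  ring

end Summit.NavierStokesRegularity.NavierStokesRegularity.Theorems.Wu2026Salvage

end

-- WHAT THIS IS NOT: not a claim about NS regularity or blow-up; not a claim about any author beyond the typed locator.
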